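import Summits.Ventures.HSemireg.Pad4TowerLineInertiaXPlus
import Summits.Ventures.HSemireg.Pad4TowerSeedB1Odd
import Summits.Ventures.HSemireg.Pad4TowerLineDesignCert12

/-!
# Pad4Tower ∕ LinePhaseRigidity — Part B UNIT PHASE RIGIDITY (h-uniform: the unit hub, the UNIT SIBLING EXCLUSION, `Δ`∕`S₄` on the LINE, THE UNIT TWIN LAW) and Part C THE PHASE-TYPE THRESHOLD LAW (typed statements `OddFCFreeLine`∕`AntipodalFCLine`∕`PureFCLine`∕`OddLineThresholdLaw`∕`PhaseTypeLaw`; the `h = 12` side PROVED from the tree certificate `Pad4TowerLineDesignCert12`)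
# (HSemireg support file; PT-PORT-2 (a2), tree copy of control's crux workfile)

Crux of record: `Summit.HodgeConjecture.HodgeConjecture.Theses.EightfoldBlochSeeds.BlochSeedDiscOne` (= `HasHyperbolicBlochSeed 4 1`, item
stmt-HodgeConjecture-18881; skeleton `Cruxes/BlochSeedDiscOne/Lines/birth.lean` 814a6a70c14e831a, STUB R `stub_rung_pad4_seedAt`, UNTOUCHED).
Nothing in this file proves HC, HC_AV, HC_CM, H2, item 18881, (T₈) or (T₁₀); census-neutral (no SAT∕UNSAT row is added or changed). Statements about
the typed FIRST-ORDER static game on the LINE alphabet of the PAD-4 design tower (`RuleDMu4Closed`, `XPlusClosed`, `G1Closed` of record) — H₁-static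
letter DESIGNS, not sheaves, monads or seeds; HC_CM is a displayed binder of the ladder only, unused here.

PROVENANCE. TREE COPY — statements AND proofs verbatim; new are only the namespace `Summit.Ventures.HSemireg.Pad4Tower.LinePhaseRigidity`, this module docstring, the module boundary, the
`import`∕`open` of the tree toolkit `Pad4TowerLineInertiaLetters`∕`…XPlus` (namespace `…Pad4Tower.LineInertia`, = the workfile's Part A + §C1, landed
separately under the same key) and one-line docstrings where the gate requires them (v2: the STATUS sentences of `OddLineThresholdLaw` ∕ `PhaseTypeLaw` re-worded as crux-workfile references, review p777046) — of Part B (§B1–§B2) and Part C §C2–§C3 (§C1, the census glue, is in the toolkit module `Pad4TowerLineInertiaXPlus`) of the crux workfile `Cruxes/BlochSeedDiscOne/LinePhaseRigidity.lean` v1.9 (author plan-lens-HodgeAV-control g9; crux commit f5c30e1c3066, sha16 f0ad6d2122a71d9c; critic plates idea-crit-6 g15 PASS). Filed in the tree on plan-lens-HodgeAV-control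
g10's KEY (a2) (bus l.10147: «LinePhaseRigidity Parts B–F → tree, so that `DiamondLevelLaws.LineFloorDepth h` (∀ h) is a tree theorem») by
hsemireg-phasetorus-typer-1 g3. Module set of (a2): `Pad4TowerLinePhaseRigidityUnits` (Parts B, C) → `Pad4TowerLinePhaseRigidityModel` (Part D) →
`Pad4TowerLinePhaseRigidityGap` (Parts E, F). 0 sorry, 0 named facts, no instance ∕ notation ∕ set_option ∕ native_decide; docstring on every declaration.

CONTENT. Part B: `apex_eq`, `exists_third`, **`unit_hub_mem`** (a RULE-D `P`-cell with a UNIT letter `(1,k)@σ` has its hub `P(σ ↦ hI)` on the `N` level),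
**`unit_sibling_exclusion`** (no present sibling `P(σ ↦ (1,k″))`, `k″ ≠ k`, next to an apex letter — every `h`, no symmetry), `unit_phase_rigid`;
`deltaPt_lineLetter` (Δ retards the tag), `MConfig.G1Closed` transport on the LINE, **`unit_twin_law`**. Part C: `kbit_lineLetter`, `AntipodalCell`∕`PureCell`
phase classes, the typed laws (OL_h) `OddFCFreeLine h`, (AP_h) `AntipodalFCLine h`, (PP_h) `PureFCLine h`, `OddLineThresholdLaw`, `PhaseTypeLaw` (control's
statements of record, verbatim) and **`not_oddFCFreeLine_twelve`** (the SAT side at `h = 12`, from `LineDesignCert12.cfg_*` + the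
toolkit's `lsupport_of_diamond_ceiling`).
-/

namespace Summit.Ventures.HSemireg.Pad4Tower.LinePhaseRigidity

open Finset Summit.Ventures.HSemireg.Pad4Tower Summit.Ventures.HSemireg.LinePhaseTorus Summit.Ventures.HSemireg.Pad4Tower.LineInertia

/-! # Part B — UNIT PHASE RIGIDITY (h-uniform, structural; the only place where phases interact is the `X+` clause) -/

/-! ## §B1 The unit hub and the UNIT SIBLING EXCLUSION (no symmetry, every `h`) -/

/-- an effective LINE letter which is an apex point is the apex `hI` itself. -/
theorem apex_eq {h : ℤ} {x : BPoint} (hx : IsLL h x) (ha : isApex x) : x = (h, 0, 0) := by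
  obtain ⟨c, k, -, rfl⟩ := hx
  rw [(isApex_lineLetter_iff h c k).1 ha, lineLetter_zero]

/-- any two factors leave a third (copy of `LineInertia.exists_third`). -/
theorem exists_third (s g : Fin 4) : ∃ f : Fin 4, f ≠ s ∧ f ≠ g := by
  revert s g; decide

/-- **THE UNIT HUB.** A RULE-D `P`-cell whose `σ`-letter is a UNIT LINE letter `(1, k)` has its HUB `P(σ ↦ hI)` present on the `N` level:
by (RD-P) the cell is served strictly below along that letter's own ray, and the only LINE letter below a unit letter is the apex. -/
theorem unit_hub_mem {h : ℤ} {C : MConfig} (hlow : ∀ N ∈ C.lower, ∀ f, IsLL h (N f)) {P : MCell} (hPL : ∀ f, IsLL h (P f))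
    (hD : RuleDMu4P C P) {σ : Fin 4} {k : Fin 4} (hσ : P σ = lineLetter h 1 k) :
    Function.update P σ (h, 0, 0) ∈ C.lower := by
  obtain ⟨N, hN, c', hc', rfl⟩ := p_up_server hlow hPL hD hσ le_rfl
  have hc0 : c' = 0 := by omega
  subst hc0
  rwa [lineLetter_zero] at hN

/-- **UNIT SIBLING EXCLUSION** (h-uniform, NO symmetry). In a RULE-D-closed, `X+`-closed configuration of effective LINE-`h` cells, a present
`P`-cell with the apex letter on a factor `f` and a UNIT letter `(1, k)` on `σ ≠ f` has NO PRESENT SIBLING on `σ`: for every phase `k″ ≠ k`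
the cell `P(σ ↦ (1, k″))` is absent from the `P` level. (The unit hub is present (`unit_hub_mem`); a unit letter has nothing shallower of
its phase on its ray and a unit sibling has no companion, so the apex-demand clause fires: `xplus_fires` with `c = e = 1`, both side
conditions vacuous.) This is the ONLY coupling between phases in the typed statics on the LINE, and it is rigid at charge 1. -/
theorem unit_sibling_exclusion {h : ℤ} {C : MConfig} (hC : LSupport h C) (hD : RuleDMu4Closed C) (hX : XPlusClosed C)
    {P : MCell} (hP : P ∈ C.upper) {σ f : Fin 4} (hfσ : f ≠ σ) (hPf : P f = (h, 0, 0)) {k : Fin 4} (hσ : P σ = lineLetter h 1 k)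
    {k'' : Fin 4} (hk'' : k'' ≠ k) : Function.update P σ (lineLetter h 1 k'') ∉ C.upper := by
  intro hsib
  have hN₀ := unit_hub_mem hC.1 (hC.2 P hP) (hD.2 P hP) hσ
  exact xplus_fires hC.1 hP hfσ hσ le_rfl hPf hN₀ (fun c' h1 h2 => by omega) hk'' le_rfl hsib
    (fun e' h1 h2 => by omega) hX

/-- **UNIT PHASE RIGIDITY** (the same, as uniqueness): off an apex factor, the phase of a unit letter of a present `P`-cell is DETERMINED by
the other three letters — if `P(σ ↦ (1, k₁))` and `P(σ ↦ (1, k₂))` are both present then `k₁ = k₂`. -/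
theorem unit_phase_rigid {h : ℤ} {C : MConfig} (hC : LSupport h C) (hD : RuleDMu4Closed C) (hX : XPlusClosed C)
    {P : MCell} {σ f : Fin 4} (hfσ : f ≠ σ) (hPf : isApex (P f)) {k₁ k₂ : Fin 4}
    (h₁ : Function.update P σ (lineLetter h 1 k₁) ∈ C.upper) (h₂ : Function.update P σ (lineLetter h 1 k₂) ∈ C.upper) : k₁ = k₂ := by
  by_contra hne
  have hf1 : Function.update P σ (lineLetter h 1 k₁) f = (h, 0, 0) := by
    have e : Function.update P σ (lineLetter h 1 k₁) f = P f := Function.update_of_ne hfσ _ _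
    have hL := hC.2 _ h₁ f
    rw [e] at hL ⊢
    exact apex_eq hL hPf
  have hσ1 : Function.update P σ (lineLetter h 1 k₁) σ = lineLetter h 1 k₁ := Function.update_self _ _ _
  have habs := unit_sibling_exclusion hC hD hX h₁ hfσ hf1 hσ1 (k'' := k₂) (Ne.symm hne)
  rw [Function.update_idem] at habs
  exact habs h₂

/-! ## §B2 `G₁ = ⟨Δ⟩ × S₄` on the LINE and THE UNIT TWIN LAW (every `h`) -/

/-- `Δ` (`Pad4TowerDeltaWindow.deltaPt`, `β ↦ iβ`) RETARDS the phase tag of a LINE letter by one: `(c, k) ↦ (c, k + 3)`. -/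
theorem deltaPt_lineLetter (h : ℤ) (c : ℕ) (k : Fin 4) : deltaPt (lineLetter h c k) = lineLetter h c (k + 3) := by
  fin_cases k <;> simp [deltaPt, lineLetter]

/-- `Δ` fixes the apex. -/
theorem deltaPt_apex (h : ℤ) : deltaPt (h, 0, 0) = (h, 0, 0) := by
  simp [deltaPt]

/-- in `Fin 4`: `k + 1 + 3 = k`. -/
theorem add_one_add_three (k : Fin 4) : k + 1 + 3 = k := by
  fin_cases k <;> decide

/-- in `Fin 4`: `k + 3 ≠ k + 1`. -/
theorem add_three_ne_add_one (k : Fin 4) : k + 3 ≠ k + 1 := by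
  fin_cases k <;> decide

/-- in `Fin 4`: `k + 3 + 1 = k`. -/
theorem add_three_add_one (k : Fin 4) : k + 3 + 1 = k := by
  fin_cases k <;> decide

/-- in `Fin 4`: the four cases for a second phase relative to a first. -/
theorem phase_cases (k k' : Fin 4) : k' = k ∨ k' = k + 1 ∨ k' = k + 2 ∨ k' = k + 3 := by
  fin_cases k <;> fin_cases k' <;> decide

/-- **THE UNIT TWIN LAW** (h-uniform; symmetry `G₁ = ⟨Δ⟩ × S₄` = `MConfig.G1Closed` of `Pad4TowerSeedB1`, the census's `JOB_ORBIT=g1`).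
A `G₁`-closed, RULE-D-closed, `X+`-closed effective LINE-`h` support contains NO `P`-cell `P(hI, hI, (1,k), (1,k+1))` — two apex letters and two
UNIT letters of ADJACENT phases, on any factors: its `G₁`-twin `swap(σ,τ) ∘ Δ` of it is the sibling `P(τ ↦ (1, k+3))` (the two apex letters
are phase-blind), and `unit_sibling_exclusion` applies. (Antipodal unit pairs `(1,k), (1,k+2)` are NOT excluded — `Δ²` maps the pair to
itself; they occur from `h = 4` on; equal phases occur in `FC8G1`.) -/
theorem unit_twin_law {h : ℤ} {C : MConfig} (hC : LSupport h C) (hG : C.G1Closed) (hD : RuleDMu4Closed C) (hX : XPlusClosed C)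
    {P : MCell} (hP : P ∈ C.upper) {σ τ : Fin 4} (hστ : σ ≠ τ) {k : Fin 4} (hσ : P σ = lineLetter h 1 k)
    (hτ : P τ = lineLetter h 1 (k + 1)) (hrest : ∀ f, f ≠ σ → f ≠ τ → P f = (h, 0, 0)) : False := by
  obtain ⟨f, hfσ, hfτ⟩ := exists_third σ τ
  have hQ : (P.delta).perm (Equiv.swap σ τ) ∈ C.upper := hG.2.1 _ _ (hG.2.2.2 P hP)
  have hQeq : (P.delta).perm (Equiv.swap σ τ) = Function.update P τ (lineLetter h 1 (k + 3)) := by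
    funext g
    simp only [MCell.perm, MCell.delta]
    by_cases hgσ : g = σ
    · subst hgσ
      rw [Equiv.swap_apply_left, hτ, deltaPt_lineLetter, Function.update_of_ne hστ, hσ, add_one_add_three]
    · by_cases hgτ : g = τ
      · subst hgτ
        rw [Equiv.swap_apply_right, hσ, deltaPt_lineLetter, Function.update_self]
      · rw [Equiv.swap_apply_of_ne_of_ne hgσ hgτ, Function.update_of_ne hgτ, hrest g hgσ hgτ, deltaPt_apex]
  rw [hQeq] at hQ
  exact unit_sibling_exclusion hC hD hX hP hfτ (hrest f hfσ hfτ) hτ (add_three_ne_add_one k) hQ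

/-- **UNIT PAIRS ARE PURE OR ANTIPODAL** (every `h`, `G₁`): in a `G₁`-closed static-closed effective LINE-`h` support, a present `P`-cell with two
apex letters and two unit letters `(1,k)`, `(1,k′)` has `k′ = k` or `k′ = k + 2`. -/
theorem unit_pair_antipodal {h : ℤ} {C : MConfig} (hC : LSupport h C) (hG : C.G1Closed) (hD : RuleDMu4Closed C) (hX : XPlusClosed C)
    {P : MCell} (hP : P ∈ C.upper) {σ τ : Fin 4} (hστ : σ ≠ τ) {k k' : Fin 4} (hσ : P σ = lineLetter h 1 k)
    (hτ : P τ = lineLetter h 1 k') (hrest : ∀ f, f ≠ σ → f ≠ τ → P f = (h, 0, 0)) : k' = k ∨ k' = k + 2 := by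
  rcases phase_cases k k' with h0 | h1 | h2 | h3
  · exact Or.inl h0
  · subst h1
    exact (unit_twin_law hC hG hD hX hP hστ hσ hτ hrest).elim
  · exact Or.inr h2
  · subst h3
    refine (unit_twin_law hC hG hD hX hP hστ.symm hτ ?_ fun f h1 h2 => hrest f h2 h1).elim
    rw [hσ, add_three_add_one]


/-! ## §C2 Phase classes of LINE cells and the parity pattern -/

/-- the parity bit of a charged LINE letter is its phase tag mod 2 (`Im β ≠ 0` iff `k` odd). -/
theorem kbit_lineLetter {h : ℤ} {c : ℕ} (hc : 1 ≤ c) (k : Fin 4) : kbit (lineLetter h c k) = k.val % 2 := by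
  have hc0 : c ≠ 0 := by omega
  fin_cases k <;> simp [kbit, lineLetter, hc0]

/-- a cell is (cellwise) ANTIPODAL on the LINE: all its CHARGED letters have phases in one antipodal class `{k₀, k₀ + 2}`
(phase-pure cells — one phase — are antipodal). -/
def AntipodalCell (h : ℤ) (X : MCell) : Prop :=
  ∃ k₀ : Fin 4, ∀ f : Fin 4, ∀ c : ℕ, ∀ k : Fin 4, X f = lineLetter h c k → 1 ≤ c → (k = k₀ ∨ k = k₀ + 2)

/-- a cell is PHASE-PURE on the LINE: all its charged letters carry one phase. -/
def PureCell (h : ℤ) (X : MCell) : Prop :=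
  ∃ k₀ : Fin 4, ∀ f : Fin 4, ∀ c : ℕ, ∀ k : Fin 4, X f = lineLetter h c k → 1 ≤ c → k = k₀

/-- pure cells are antipodal. -/
theorem antipodal_of_pure {h : ℤ} {X : MCell} (hX : PureCell h X) : AntipodalCell h X := by
  obtain ⟨k₀, hk⟩ := hX
  exact ⟨k₀, fun f c k e hc => Or.inl (hk f c k e hc)⟩

/-- in `Fin 4`, `k₀` and `k₀ + 2` have the same parity. -/
theorem parity_add_two (k₀ : Fin 4) : (k₀ + 2).val % 2 = k₀.val % 2 := by
  fin_cases k₀ <;> decide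

/-- **AN ANTIPODAL FULLY CHARGED LINE CELL HAS EVEN PARITY WEIGHT** (its four parity bits agree, so its pattern is `0000` or `1111`):
the bridge from the phase-type law to the census's `HasOddFC`. -/
theorem not_oddPat_of_antipodal {h : ℤ} {X : MCell} (hXL : ∀ f, IsLL h (X f)) (hA : AntipodalCell h X) (hFC : FCc X) :
    ¬ OddPat X.pat := by
  obtain ⟨k₀, hk⟩ := hA
  -- every parity bit equals `k₀ % 2`
  have hbit : ∀ f, kbit (X f) = k₀.val % 2 := by
    intro f
    obtain ⟨c, k, -, e⟩ := hXL f
    have hc : 1 ≤ c := by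
      rcases Nat.eq_zero_or_pos c with h0 | h0
      · exfalso; subst h0
        exact hFC f (by rw [e, lineLetter_zero])
      · exact h0
    rw [e, kbit_lineLetter hc]
    rcases hk f c k e hc with rfl | rfl
    · rfl
    · exact parity_add_two k₀
  have hb : k₀.val % 2 = 0 ∨ k₀.val % 2 = 1 := by omega
  intro hodd
  simp only [OddPat, MCell.pat, Fin.ext_iff, hbit] at hodd
  rcases hb with hb | hb <;> simp only [hb] at hodd <;> omega

/-! ## §C3 The statements: (OL_h) ODD-FC-FREE LINE, (PT) phase-type classes; the law; the `h = 12` side PROVED -/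

/-- **(OL_h) THE ODD-FC-FREE LINE AT HEIGHT `h`**: every `G₁`-closed, RULE-D-closed, `X+`-closed support of effective LINE-`h` cells has NO fully
charged cell of odd parity weight (the census's `HasOddFC`, `Pad4TowerSeedB1Odd`), on either level. The LINE restriction of the census statement
`SeedB1OddDiamondG1H1 h` with `A2I−` dropped (vacuous on the LINE, `LineInertia` §8 ∕ `LineDesignCert12.a2iMinusClosed_of_onCeiling`). -/
def OddFCFreeLine (h : ℤ) : Prop :=
  ∀ C : MConfig, LSupport h C → C.G1Closed → RuleDMu4Closed C → XPlusClosed C → ¬ C.HasOddFC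

/-- **(AP_h) ANTIPODAL FC AT HEIGHT `h`**: in every such support every fully charged cell is antipodal (charged phases in one class `{k₀, k₀+2}`). -/
def AntipodalFCLine (h : ℤ) : Prop :=
  ∀ C : MConfig, LSupport h C → C.G1Closed → RuleDMu4Closed C → XPlusClosed C →
    ∀ X ∈ C.lower ∪ C.upper, FCc X → AntipodalCell h X

/-- **(PP_h) PURE FC AT HEIGHT `h`**: in every such support every fully charged cell is phase-pure. -/
def PureFCLine (h : ℤ) : Prop :=
  ∀ C : MConfig, LSupport h C → C.G1Closed → RuleDMu4Closed C → XPlusClosed C →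
    ∀ X ∈ C.lower ∪ C.upper, FCc X → PureCell h X

/-- (PP_h) ⇒ (AP_h). -/
theorem antipodalFCLine_of_pure {h : ℤ} (hP : PureFCLine h) : AntipodalFCLine h :=
  fun C hC hG hD hX X hX' hFC => antipodal_of_pure (hP C hC hG hD hX X hX' hFC)

/-- **(AP_h) ⇒ (OL_h)**: antipodal fully charged cells have even parity weight. -/
theorem oddFCFreeLine_of_antipodal {h : ℤ} (hA : AntipodalFCLine h) : OddFCFreeLine h := by
  intro C hC hG hD hX hodd
  rcases hodd with ⟨Z, hZ, hFC, hpat⟩ | ⟨P, hP, hFC, hpat⟩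
  · exact not_oddPat_of_antipodal (hC.1 Z hZ) (hA C hC hG hD hX Z (Finset.mem_union_left _ hZ) hFC) hFC hpat
  · exact not_oddPat_of_antipodal (hC.2 P hP) (hA C hC hG hD hX P (Finset.mem_union_right _ hP) hFC) hFC hpat

/-- **THE SAT SIDE AT `h = 12` (PROVED, from the tree's kernel certificate `Pad4TowerLineDesignCert12`):** `(OL₁₂)` is FALSE — the 768-cell
`G₁`-closed LINE-12 design `1beef026ebdf95b9` (19 `G₁`-orbits; kit j326579 ∕ j326707 ∕ j326935) is RULE-D-closed, `X+`-closed and carries the odd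
fully charged orbit of `P[10I+ℓ₁ ∣ 10I+ℓ₁ ∣ 10I+ℓ₁ ∣ 8I+2ℓ_{i^3}]` (phase type `0003`, charges `(1,1,1,2)`). -/
theorem not_oddFCFreeLine_twelve : ¬ OddFCFreeLine 12 := by
  intro hOL
  refine hOL LineDesignCert12.cfg ?_ LineDesignCert12.cfg_g1Closed LineDesignCert12.cfg_ruleDMu4Closed
    LineDesignCert12.cfg_xPlusClosed LineDesignCert12.cfg_hasOddFC
  exact lsupport_of_diamond_ceiling LineDesignCert12.cfg_inDiamond
    ⟨fun Z hZ => LineDesignCert12.lN_onLine Z (LineDesignCert12.mem_lower_iff.mp hZ),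
     fun P hP => LineDesignCert12.lP_onLine P (LineDesignCert12.mem_upper_iff.mp hP)⟩

/-- hence `(AP₁₂)` and `(PP₁₂)` are false too. -/
theorem not_antipodalFCLine_twelve : ¬ AntipodalFCLine 12 :=
  fun hA => not_oddFCFreeLine_twelve (oddFCFreeLine_of_antipodal hA)

/-- `not_pureFCLine_twelve` (Part C; tree copy, statement verbatim). -/
theorem not_pureFCLine_twelve : ¬ PureFCLine 12 :=
  fun hP => not_antipodalFCLine_twelve (antipodalFCLine_of_pure hP)

/-- **THE ODD THRESHOLD LAW ON THE LINE** (the control lens's «law in `h`» for the odd core, typed): below height `12` the `G₁`-statics on the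
LINE exclude odd fully charged cells; at `12` they do not. STATUS IN THE TREE: a typed statement (`def … : Prop`), NOT proved in this
module. The second conjunct is `not_oddFCFreeLine_twelve` above (PROVED here); the first conjunct is proved in the crux workfile
`Cruxes/BlochSeedDiscOne/LinePhaseRigidity.lean` v1.9 Part J (`oddLineThresholdLaw_holds`, not in this module; its tree port is the later chain
module `Pad4TowerLinePhaseRigidityNucleus2`), where it was first MACHINE-CERTIFIED in the closed-form model of Part A (the WORKFILE's census
`oddline.py` ∕ `thresholds.py`, not this module's: the `G₁`-orbit SAT instances built from `p_up_server`, `n_down_server`, `n_hub_alternative`,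
`xplus_fires` alone are UNSAT at `h = 8, 10`; sizes 2 450 ∕ 5 352 orbit variables, cadical 52 ∕ 59 conflicts), in agreement with the W-LINE census
of record (LINE-8 ∕ LINE-10 odd-FC UNSAT ×2, LINE-12 SAT = `Cert12`); the remark «`h ≤ 6` has no fully charged cell at all» is the workfile's
`LineInertia.lean` §12 (`no_fc_line6` ∕ `fc_threshold`), which is NOT part of the tree toolkit `…Pad4Tower.LineInertia`. -/
def OddLineThresholdLaw : Prop := (∀ h : ℤ, h ≤ 10 → OddFCFreeLine h) ∧ ¬ OddFCFreeLine 12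

/-- the finer **PHASE-TYPE THRESHOLD LAW** at the two heights that matter (typed; STATUS IN THE TREE: a typed statement, NOT proved in this
module — same status as the first conjunct of `OddLineThresholdLaw`, from the same closed-form census of the crux workfile; the full table for all
ten phase types and both levels, `h = 4 … 16`, is in the module docstring of the WORKFILE `Cruxes/BlochSeedDiscOne/LinePhaseRigidity.lean`):
`(PP₈)` every fully charged cell of a `G₁`-static LINE-8 support is PHASE-PURE (even `S₄` alone suffices in the model);
`(AP₁₀)` every fully charged cell of a `G₁`-static LINE-10 support is ANTIPODAL (type `0000` or `0022`); both imply `(OL₈)`, `(OL₁₀)`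
by `oddFCFreeLine_of_antipodal`.  Proved in the crux workfile v1.9 Part K (`phaseTypeLaw_holds`, h-uniform forms `pureFCLine_of_lt_ten`,
`antipodalFCLine_of_lt_twelve` — not in this module; their tree port is the later chain module `Pad4TowerLinePhaseRigidityPhaseType`). -/
def PhaseTypeLaw : Prop := PureFCLine 8 ∧ AntipodalFCLine 10

/-- the typed reduction: the phase-type law at `8` and `10` gives the odd-free side of the threshold law at those heights. -/
theorem oddFCFree_of_phaseTypeLaw (hPT : PhaseTypeLaw) : OddFCFreeLine 8 ∧ OddFCFreeLine 10 :=
  ⟨oddFCFreeLine_of_antipodal (antipodalFCLine_of_pure hPT.1), oddFCFreeLine_of_antipodal hPT.2⟩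

end Summit.Ventures.HSemireg.Pad4Tower.LinePhaseRigidity
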